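import Literature.MathematicalPhysics.QuantumFieldTheory.Balaban1983to89.B9RWSumsCompleteGeo9YRel
import Literature.MathematicalPhysics.QuantumFieldTheory.Balaban1983to89.B9RWSumsDefinitePins

/-!
# `Balaban1983to89.B9RWSumsDefinitePinsRel` — rows 13 ∕ 18 ∕ 19 of the N06 census as ONE face at def-Y's members, with the
# all-blocks constants DEFINITE (scaled by the class multiplicity) and every co-reading RELATIVE TO A BLOCK EQUIVALENCE: the knit's
# binders reduced to two sign records, one block equivalence with its multiplicity ∕ saturation, and the operator-level schemas
# (the `Rel` twin of `B9RWSumsDefinitePins`)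

T. Bałaban, *Propagators for lattice gauge theories in a background field*, Commun. Math. Phys. **99** (1985) 389–434
[`Balaban1985BackgroundPropagators`, "B9"], Thm 3.7 p. 409, Cor. 3.8 p. 410, Thm 3.10 pp. 415–416, Thm 3.1 p. 397 (*"There exist
positive constants B₀, δ₀, B₀(β), B′₀(ε), B′₀(ε,β) …"*); [4] = T. Bałaban, *Propagators and renormalization transformations for
lattice gauge theories. II*, Commun. Math. Phys. **96** (1984) 223–250 [`Balaban1984PropagatorsII`], Lemma 2.1 pp. 233–234.

statement-level skeleton of published theorems with citation tags; proofs where landed; nothing here is a claim about the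
Yang–Mills mass gap

WHY THIS FILE.  The N06 knit at def-Y's instance folds rows 13∕18∕19 through `B9RWSumsDefinitePins.rows131819_definite_geo9Y p q hp hq …`
(two `PinPrims` records, the definite E-letters `E37Y`∕`E310Y`) — whose co-reading binder classes `hco∕hl∕hH1∕hIR` (both sides) are the
ONE-FIBRE schemas, unsatisfiable at the record (referee dag-ref-A READ-18).  THIS FILE is the agreed swap (n06-d g4, pub-ymgap INBOX
2026-08-27 l.16111: *"one swap, one file"*): the SAME face with those classes in the `Rel` species and ONE block equivalence `Rel x` per
member with multiplicity ≦ m (at the record: «same carrier block», m = the number of index bonds of a block) and Lʲη, d saturated on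
classes; the multiplicity is absorbed by scaling the shared constants B₁ and B₀(·) by `relScale m` = m² + 1 in the definite E-letters
`E37YRel m p q …` ∕ `E310YRel m p q …` (δ₁, B′₀(·), B′₀(·,·) unchanged).

* §1 `relScale`, ★ `E37YRel`, ★ `E310YRel` (pin targets for `(ops x).E37` ∕ `(ops x).E310`).
* §2 ★★★ `rows131819_definite_geo9Y_rel` — `Thm37Printed ∧ Cor38Printed ∧ Thm310Printed ∧ RWSumsYieldIneqs` at the `Rel` E-letters
  from `hp hq`, the block equivalence data, and the operator-level inputs of both sides (binder classes VERBATIM the sibling's with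
  the co-readings swapped to `CoRealizesRel`∕`GlobReads`∕`L2ReadsRel`∕`H1ReadsRel`∕`InputReadsRel`).

HONEST SCOPE.  Definitions by choice (`relScale`, the two E-letters) and kernel bookkeeping; nothing of [B9] or [4] asserted; every
remaining hypothesis is operator-level, a relative co-reading, a letter, a support count or a sign.  NOT a node discharge; count-neutral;
one finite 𝕋^{d+1} programme at fixed ε — nothing continuum, nothing about the mass gap.  Cell `pub-ymgap` (HUMAN RULING D-0062), Track A
node N06 [B9], N06-ASSIGNMENT v1 bundle F6 (rows 18–19), seat `pub-ymgap-dag-n06-k` (gen 5), 2026-08-27.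
-/
namespace Literature.MathematicalPhysics.QuantumFieldTheory.Balaban1983to89.B9RWSumsDefinitePinsRel

open Literature.MathematicalPhysics.QuantumFieldTheory.Balaban1983to89
open Finset B6RandomWalk B9Thm34Ext B9Thm37Whole B9Cor38Whole B9Thm310Whole B9RowSum261Faces B9RowSum261DefiniteFaces
open B9Ineq349Whole B9RWSums343to347Whole B9PinMembersKLevelV1 B9GeoLemma21KLevelV1 B9RWSums347DefiniteFaces
open B9Thm37GlueCor36 B9Thm37Glue B9RWSums346Schur B9RWSums343Holder B9RWSums343HolderGp B9RWSums346Lap B9RWSums344Input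
open B9RWSums344InputGp B9RWSums346Two B9RWSums346TwoGp B11SectG B9RWSumsCompleteGeo9Y B9RWSumsDefinitePins
open B9CoRealizesRel B9RWSumsReadsRel B9RWSumsAllBlocksRel B9RWSumsCompleteGeo9YRel

noncomputable section

/-! ## §1 The multiplicity scale and the definite E-letters of the `Rel` face -/

/-- the scale by which the shared all-blocks constants absorb the class multiplicity m: `m·m + 1` (≧ 1, ≧ m, ≧ m²).
[cite: Balaban1985BackgroundPropagators, Thm 3.1 p.397 («There exist positive constants B₀ …»), bookkeeping] -/
def relScale (m : ℕ) : ℝ := (m : ℝ) * m + 1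

/-- `lowerB_{G′} ≤ B1Y` (twin of the sibling's private lemma). [folklore] -/
private theorem lowerB_le_B1Y_left' (p q : PinPrims) (dp dFp dq dFq : ℕ) (L₀ : ℝ) :
    p.lowerB dp dFp p.N' L₀ ≤ B1Y p q dp dFp dq dFq L₀ :=
  (le_max_left _ _).trans (le_max_right _ _)

/-- `lowerB_G ≤ B1Y` (twin of the sibling's private lemma). [folklore] -/
private theorem lowerB_le_B1Y_right' (p q : PinPrims) (dp dFp dq dFq : ℕ) (L₀ : ℝ) :
    q.lowerB dq dFq q.NF L₀ ≤ B1Y p q dp dFp dq dFq L₀ :=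
  (le_max_right _ _).trans (le_max_right _ _)

/-- `C ≤ pinLowerB …`. [folklore] -/
private theorem le_pinLowerB₁' (C cF lapC twoC L₀ : ℝ) : C ≤ pinLowerB C cF lapC twoC L₀ :=
  (le_max_left _ _).trans ((le_max_left _ _).trans ((le_max_left _ _).trans (le_max_left _ _)))

/-- `C·L₀ ≤ pinLowerB …`. [folklore] -/
private theorem le_pinLowerB₂' (C cF lapC twoC L₀ : ℝ) : C * L₀ ≤ pinLowerB C cF lapC twoC L₀ :=
  (le_max_right _ _).trans ((le_max_left _ _).trans ((le_max_left _ _).trans (le_max_left _ _)))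

/-- `C·c_F·L₀⁴ ≤ pinLowerB …`. [folklore] -/
private theorem le_pinLowerB₃' (C cF lapC twoC L₀ : ℝ) : C * cF * L₀ ^ (4 : ℝ) ≤ pinLowerB C cF lapC twoC L₀ :=
  (le_max_right _ _).trans ((le_max_left _ _).trans (le_max_left _ _))

/-- `√(C·lapC)·L₀ ≤ pinLowerB …`. [folklore] -/
private theorem le_pinLowerB₄' (C cF lapC twoC L₀ : ℝ) : Real.sqrt (C * lapC) * L₀ ≤ pinLowerB C cF lapC twoC L₀ :=
  (le_max_right _ _).trans (le_max_left _ _)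

/-- `twoC ≤ pinLowerB …`. [folklore] -/
private theorem le_pinLowerB₅' (C cF lapC twoC L₀ : ℝ) : twoC ≤ pinLowerB C cF lapC twoC L₀ :=
  le_max_right _ _

section StageY

variable {d ℓ : ℕ} {hd : 1 ≤ d + 1} {hL : Odd (ℓ + 1) ∧ 1 < ℓ + 1} {b₀ b₁ : ℝ} {Mstar : ℕ}
variable [∀ x : MemberY d ℓ hd hL b₀ b₁ Mstar, Fintype (geo9Y x).Site]
  [∀ x : MemberY d ℓ hd hL b₀ b₁ Mstar, DecidableEq (geo9Y x).Site]
variable {c35 : ℝ} {bg : MemberY d ℓ hd hL b₀ b₁ Mstar → B9.Backgrounds}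

/-- ★ **THE DEFINITE E-LETTER OF THEOREM 3.7 ∕ COROLLARY 3.8 AT A MEMBER FOR THE `Rel` FACE**: the sibling's `E37Y` with the shared
constants B₁ and B₀(·) scaled by `relScale m` = m² + 1 (the class multiplicity of the relative co-readings absorbed); δ₁, B′₀(·),
B′₀(·,·) unchanged.  OURS (a pin target for `(ops x).E37`). [cite: Balaban1985BackgroundPropagators, Thm 3.7 (3.90) p.409 + Cor. 3.8 (3.93)–(3.94) p.410 + Thm 3.1 (3.42)–(3.47) pp.397–398] -/
def E37YRel (m : ℕ) (p q : PinPrims) {x : MemberY d ℓ hd hL b₀ b₁ Mstar} {X Y ι : Type} (𝔬 : Ops (geo9Y x) (bg x) X Y ι)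
    (rd : WalkReading (geo9Y x) (bg x) X ι) (H : Prop) (K : B9.KernelFamily (geo9Y x) (bg x)) :
    B9.RWExpansion (geo9Y x) (bg x) :=
  E37AllOfOps
    (W38OfOps 𝔬 rd 1 H (p.C (exp261 (@geo9Y d ℓ hd hL b₀ b₁ Mstar) p.δ₀ p.α)) ((1 - 2 * p.α) * p.δ₀))
    𝔬 1 H (p.C (exp261 (@geo9Y d ℓ hd hL b₀ b₁ Mstar) p.δ₀ p.α)) ((1 - 2 * p.α) * p.δ₀) K
    (relScale m * B1Y p q (exp261 (@geo9Y d ℓ hd hL b₀ b₁ Mstar) p.δ₀ p.α)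
      (exp261 (@geo9Y d ℓ hd hL b₀ b₁ Mstar) ((1 - 2 * p.α) * p.δ₀) (1 - p.αF))
      (exp261 (@geo9Y d ℓ hd hL b₀ b₁ Mstar) q.δ₀ q.α)
      (exp261 (@geo9Y d ℓ hd hL b₀ b₁ Mstar) ((1 - 2 * q.α) * q.δ₀) (1 - q.αF)) ((ℓ + 1 : ℕ) : ℝ))
    (delta1Y p q)
    (fun β => relScale m *
      BbetaY p q (exp261 (@geo9Y d ℓ hd hL b₀ b₁ Mstar) p.δ₀ p.α) (exp261 (@geo9Y d ℓ hd hL b₀ b₁ Mstar) q.δ₀ q.α) β)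
    (BepsY p q (exp261 (@geo9Y d ℓ hd hL b₀ b₁ Mstar) p.δ₀ p.α) (exp261 (@geo9Y d ℓ hd hL b₀ b₁ Mstar) q.δ₀ q.α)
      ((ℓ + 1 : ℕ) : ℝ))
    (BepsbetaY p q (exp261 (@geo9Y d ℓ hd hL b₀ b₁ Mstar) p.δ₀ p.α) (exp261 (@geo9Y d ℓ hd hL b₀ b₁ Mstar) q.δ₀ q.α)
      ((ℓ + 1 : ℕ) : ℝ))

/-- ★ **THE DEFINITE E-LETTER OF THEOREM 3.10 AT A MEMBER FOR THE `Rel` FACE**: the sibling's `E310Y` with B₁ and B₀(·) scaled by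
`relScale m`.  OURS (a pin target for `(ops x).E310`). [cite: Balaban1985BackgroundPropagators, Thm 3.10 (3.107)–(3.108) pp.415–416 + Thm 3.3 p.399] -/
def E310YRel (m : ℕ) (p q : PinPrims) {x : MemberY d ℓ hd hL b₀ b₁ Mstar} {X Y ι A : Type}
    (𝔬 : Ops310 (geo9Y x) (bg x) X Y ι A) (rd : WalkReading310 (geo9Y x) (bg x) X ι A) (H : Prop)
    (K : B9.KernelFamily (geo9Y x) (bg x)) : B9.RWExpansion (geo9Y x) (bg x) :=
  W310OfOps 𝔬 rd
    (ConvAll3107 𝔬 1 H (q.C (exp261 (@geo9Y d ℓ hd hL b₀ b₁ Mstar) q.δ₀ q.α)) ((1 - 2 * q.α) * q.δ₀) K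
      (relScale m * B1Y p q (exp261 (@geo9Y d ℓ hd hL b₀ b₁ Mstar) p.δ₀ p.α)
        (exp261 (@geo9Y d ℓ hd hL b₀ b₁ Mstar) ((1 - 2 * p.α) * p.δ₀) (1 - p.αF))
        (exp261 (@geo9Y d ℓ hd hL b₀ b₁ Mstar) q.δ₀ q.α)
        (exp261 (@geo9Y d ℓ hd hL b₀ b₁ Mstar) ((1 - 2 * q.α) * q.δ₀) (1 - q.αF)) ((ℓ + 1 : ℕ) : ℝ))
      (delta1Y p q)
      (fun β => relScale m *
        BbetaY p q (exp261 (@geo9Y d ℓ hd hL b₀ b₁ Mstar) p.δ₀ p.α) (exp261 (@geo9Y d ℓ hd hL b₀ b₁ Mstar) q.δ₀ q.α) β)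
      (BepsY p q (exp261 (@geo9Y d ℓ hd hL b₀ b₁ Mstar) p.δ₀ p.α) (exp261 (@geo9Y d ℓ hd hL b₀ b₁ Mstar) q.δ₀ q.α)
        ((ℓ + 1 : ℕ) : ℝ))
      (BepsbetaY p q (exp261 (@geo9Y d ℓ hd hL b₀ b₁ Mstar) p.δ₀ p.α) (exp261 (@geo9Y d ℓ hd hL b₀ b₁ Mstar) q.δ₀ q.α)
        ((ℓ + 1 : ℕ) : ℝ)))

/-! ## §2 ★★★ Rows 13 ∕ 18 ∕ 19 as ONE face at the definite `Rel` E-letters -/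

/-- ★★★ **ROWS 13 ∕ 18 ∕ 19 OF THE N06 CENSUS AT def-Y's MEMBERS WITH DEFINITE EXPANSION DATA, EVERY CO-READING RELATIVE TO THE
INSTANCE'S BLOCK EQUIVALENCE** — the `Rel` form of `B9RWSumsDefinitePins.rows131819_definite_geo9Y` (whose one-fibre co-reading
binders are unsatisfiable at an instance whose sites share carrier blocks, referee dag-ref-A READ-18): Theorem 3.7 ∧ Corollary 3.8 at
`E37YRel m p q`, Theorem 3.10 at `E310YRel m p q` and the summation leaf for the pair, from the two sign records, ONE block equivalence
`Rel x` on each member's sites with class multiplicity ≦ m and Lʲη, d saturated on classes (at the record: «same carrier block», m =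
the number of index bonds of a block), and the OPERATOR-LEVEL inputs of both sides exactly as in the sibling — with the co-readings
`CoRealizesRel` (n06-l), `GlobReads`, `L2ReadsRel`, `H1ReadsRel`, `InputReadsRel`.  Inside: `thm37_cor38_complete_geo9Y_rel` ∕
`thm310_complete_geo9Y_rel` at B₁ := `relScale m · B1Y …`, δ₁ := `delta1Y p q`, B₀(·) := `relScale m · BbetaY …`, B′₀(·) := `BepsY …`,
B′₀(·,·) := `BepsbetaY …`, and `rwSumsYieldIneqs_allPins`.  Nothing of print asserted; NOT a node discharge.
[cite: Balaban1985BackgroundPropagators, Thm 3.7 p.409 + Cor. 3.8 p.410 + Thm 3.10 pp.415–416 + Thm 3.7 ⇒ Thm 3.1 p.410 + Thm 3.10 ⇒ Thm 3.3 p.416 + Cor. 3.6 p.408; Balaban1984PropagatorsII, (2.51)–(2.52) p.232 + Lemma 2.1 pp.233–234] -/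
theorem rows131819_definite_geo9Y_rel {X Y ι PX PY XA YA ιA AA PXA PYA : MemberY d ℓ hd hL b₀ b₁ Mstar → Type}
    [∀ x, Fintype (X x)] [∀ x, DecidableEq (X x)] [∀ x, Fintype (Y x)] [∀ x, DecidableEq (Y x)] [∀ x, Fintype (ι x)]
    [∀ x, Fintype (PX x)] [∀ x, DecidableEq (PX x)] [∀ x, Fintype (PY x)] [∀ x, DecidableEq (PY x)]
    [∀ x, Fintype (XA x)] [∀ x, DecidableEq (XA x)] [∀ x, Fintype (YA x)] [∀ x, DecidableEq (YA x)] [∀ x, Fintype (ιA x)]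
    [∀ x, Fintype (AA x)] [∀ x, Fintype (PXA x)] [∀ x, DecidableEq (PXA x)] [∀ x, Fintype (PYA x)] [∀ x, DecidableEq (PYA x)]
    (p q : PinPrims) (hp : p.OK) (hq : q.OK) (hc : 0 < c35) (H : MemberY d ℓ hd hL b₀ b₁ Mstar → Prop)
    -- the block equivalence of the instance («same carrier block»), its multiplicity and saturation
    (Rel : ∀ x : MemberY d ℓ hd hL b₀ b₁ Mstar, (geo9Y x).Site → (geo9Y x).Site → Prop) [∀ x, DecidableRel (Rel x)] (m : ℕ)
    (hRlen : ∀ x (a a' : (geo9Y x).Site), Rel x a a' → (geo9Y x).len a = (geo9Y x).len a')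
    (hRd₁ : ∀ x (a a' b : (geo9Y x).Site), Rel x a a' → (geo9Y x).dist a b = (geo9Y x).dist a' b)
    (hRd₂ : ∀ x (a b b' : (geo9Y x).Site), Rel x b b' → (geo9Y x).dist a b = (geo9Y x).dist a b')
    (hmult : ∀ x (y' : (geo9Y x).Site), (Finset.univ.filter (fun y'' => Rel x y'' y')).card ≤ m)
    -- the G′ side (Theorem 3.7 ∕ Corollary 3.8)
    (𝔬 : ∀ x : MemberY d ℓ hd hL b₀ b₁ Mstar, Ops (geo9Y x) (bg x) (X x) (Y x) (ι x))
    (rd : ∀ x : MemberY d ℓ hd hL b₀ b₁ Mstar, WalkReading (geo9Y x) (bg x) (X x) (ι x))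
    (𝔭 : ∀ x : MemberY d ℓ hd hL b₀ b₁ Mstar, HolderProbes (geo9Y x) (bg x) (X x) (Y x) (PX x) (PY x))
    (bH : ∀ x : MemberY d ℓ hd hL b₀ b₁ Mstar, ℝ → BlockNorm (toB6 (geo9Y x) 1 (H x)) (Y x → ℝ))
    (K : ∀ x : MemberY d ℓ hd hL b₀ b₁ Mstar, B9.KernelFamily (geo9Y x) (bg x))
    (ev : ∀ x : MemberY d ℓ hd hL b₀ b₁ Mstar, (geo9Y x).Loc → X x → ℝ)
    (evY : ∀ x : MemberY d ℓ hd hL b₀ b₁ Mstar, (geo9Y x).Loc → Y x → ℝ)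
    (κ : MemberY d ℓ hd hL b₀ b₁ Mstar → Sizes) (SH SL SI S2 : ∀ x : MemberY d ℓ hd hL b₀ b₁ Mstar, ι x → Finset (geo9Y x).Site)
    (hst : ∀ x, StaticOK (𝔬 x) p.ρ p.Nc p.N' p.Cℓ (κ x)) (hκ : ∀ x, (κ x).Bounded p.Kc p.θ₀ p.Cℓ (geo9Y x).M)
    (hrd : ∀ x, (rd x).OK (𝔬 x).blk) (hloc : ∀ x, Locality (𝔬 x) (rd x))
    (h36 : ∀ x, p.M₁ ≤ (geo9Y x).M → ∀ α₀ : ℝ, 0 < α₀ → c35 * (geo9Y x).M * α₀ ≤ p.a₁ →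
      ∀ U : (bg x).Cfg, (bg x).Reg335 c35 α₀ U → Local342 (𝔬 x) 1 (H x) p.B₀ p.δ₀ U ∧ Identities (𝔬 x) 1 (H x) U)
    (h36H : ∀ x, p.M₁ ≤ (geo9Y x).M → ∀ α₀ : ℝ, 0 < α₀ → c35 * (geo9Y x).M * α₀ ≤ p.a₁ →
      ∀ U : (bg x).Cfg, (bg x).Reg335 c35 α₀ U →
        HolderLegs37 (𝔬 x) (𝔭 x) 1 (H x) (SH x) p.Bl p.δ₀ U ∧ HolderV37 (𝔬 x) (𝔭 x) 1 (H x) p.Bt p.δ₀ U ∧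
          LapLegs37 (𝔬 x) 1 (H x) (SL x) p.BL p.δ₀ U ∧
            InputLegs37 (𝔬 x) (𝔭 x) 1 (H x) (bH x) (SI x) p.BI p.BI2 p.δ₀ U ∧ FactorsInput37 (𝔬 x) 1 (H x) (bH x) p.θI p.δ₀ U ∧
              L2TwoLegs37 (𝔬 x) 1 (H x) (S2 x) p.B2 p.δ₀ U ∧ FactorsL2_37 (𝔬 x) 1 (H x) p.θ2 p.δ₀ U)
    (hco0 : ∀ x U, CoRealizesRel (K x) 0 U (Rel x) (𝔬 x).blk (𝔬 x).blk (ev x) ((𝔬 x).Gp U))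
    (hco1 : ∀ x U, CoRealizesRel (K x) 1 U (Rel x) (𝔬 x).blkY (𝔬 x).blk (ev x) ((𝔬 x).D U ∘ₗ (𝔬 x).Gp U))
    (hco2 : ∀ x U, CoRealizesRel (K x) 2 U (Rel x) (𝔬 x).blk (𝔬 x).blkY (evY x) ((𝔬 x).Gp U ∘ₗ (𝔬 x).Dstar U))
    (hco3 : ∀ x U, CoRealizesRel (K x) 3 U (Rel x) (𝔬 x).blk (𝔬 x).blk (ev x) ((𝔬 x).Lap U ∘ₗ (𝔬 x).Gp U))
    (hgl0 : ∀ x U, GlobReads (K x) 0 U (𝔬 x).blk (𝔬 x).blk (ev x) ((𝔬 x).Gp U))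
    (hgl1 : ∀ x U, GlobReads (K x) 1 U (𝔬 x).blkY (𝔬 x).blk (ev x) ((𝔬 x).D U ∘ₗ (𝔬 x).Gp U))
    (hgl2 : ∀ x U, GlobReads (K x) 2 U (𝔬 x).blk (𝔬 x).blkY (evY x) ((𝔬 x).Gp U ∘ₗ (𝔬 x).Dstar U))
    (hgl3 : ∀ x U, GlobReads (K x) 3 U (𝔬 x).blk (𝔬 x).blk (ev x) ((𝔬 x).Lap U ∘ₗ (𝔬 x).Gp U))
    (hl0 : ∀ x U, L2ReadsRel (R := 1) (H := H x) (K x) 0 U (Rel x) (𝔬 x).blk (𝔬 x).blk (ev x) ((𝔬 x).Gp U))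
    (hl1 : ∀ x U, L2ReadsRel (R := 1) (H := H x) (K x) 1 U (Rel x) (𝔬 x).blkY (𝔬 x).blk (ev x) ((𝔬 x).D U ∘ₗ (𝔬 x).Gp U))
    (hl2 : ∀ x U, L2ReadsRel (R := 1) (H := H x) (K x) 2 U (Rel x) (𝔬 x).blk (𝔬 x).blkY (evY x) ((𝔬 x).Gp U ∘ₗ (𝔬 x).Dstar U))
    (hl3 : ∀ x U, L2ReadsRel (R := 1) (H := H x) (K x) 3 U (Rel x) (𝔬 x).blk (𝔬 x).blk (ev x) ((𝔬 x).Lap U ∘ₗ (𝔬 x).Gp U))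
    (hl4 : ∀ x U, L2ReadsRel (R := 1) (H := H x) (K x) 4 U (Rel x) (𝔬 x).blkY (𝔬 x).blkY (evY x)
      ((𝔬 x).D U ∘ₗ ((𝔬 x).Gp U ∘ₗ (𝔬 x).Dstar U)))
    (hl5 : ∀ x U, L2ReadsRel (R := 1) (H := H x) (K x) 5 U (Rel x) (𝔬 x).blk (𝔬 x).blk (ev x) ((𝔬 x).Gp U ∘ₗ (𝔬 x).Lap U))
    (hH1 : ∀ x U, H1ReadsRel (K x) U (𝔭 x) (Rel x) (𝔬 x).blk (𝔬 x).blkY (ev x) (evY x) ((𝔬 x).D U ∘ₗ (𝔬 x).Gp U)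
      ((𝔬 x).Gp U ∘ₗ (𝔬 x).Dstar U))
    (hIR : ∀ x U, InputReadsRel (K x) U (𝔭 x) (bH x) (Rel x) (𝔬 x).blkY (evY x) ((𝔬 x).D U ∘ₗ ((𝔬 x).Gp U ∘ₗ (𝔬 x).Dstar U)))
    (hsym : ∀ x U, IsTransposePair ((𝔬 x).Gp U) ((𝔬 x).Gp U))
    (htr : ∀ x U, IsTransposePair ((𝔬 x).D U ∘ₗ (𝔬 x).Gp U) ((𝔬 x).Gp U ∘ₗ (𝔬 x).Dstar U))
    (hadjL : ∀ x U, IsTransposePair ((𝔬 x).Lap U ∘ₗ (𝔬 x).Gp U) ((𝔬 x).Gp U ∘ₗ (𝔬 x).Lap U))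
    (hcntH : ∀ x (a : (geo9Y x).Site), (∑ c, if a ∈ SH x c then (1 : ℝ) else 0) ≤ p.NH)
    (hcntL : ∀ x (a : (geo9Y x).Site), (∑ c, if a ∈ SL x c then (1 : ℝ) else 0) ≤ p.NL)
    (hcntI : ∀ x (a : (geo9Y x).Site), (∑ c, if a ∈ SI x c then (1 : ℝ) else 0) ≤ p.NI)
    (hcnt2 : ∀ x (a : (geo9Y x).Site), (∑ c, if a ∈ S2 x c then (1 : ℝ) else 0) ≤ p.N2)
    -- the G side (Theorem 3.10)
    (𝔬A : ∀ x : MemberY d ℓ hd hL b₀ b₁ Mstar, Ops310 (geo9Y x) (bg x) (XA x) (YA x) (ιA x) (AA x))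
    (rdA : ∀ x : MemberY d ℓ hd hL b₀ b₁ Mstar, WalkReading310 (geo9Y x) (bg x) (XA x) (ιA x) (AA x))
    (𝔭A : ∀ x : MemberY d ℓ hd hL b₀ b₁ Mstar, HolderProbes (geo9Y x) (bg x) (XA x) (YA x) (PXA x) (PYA x))
    (bHA : ∀ x : MemberY d ℓ hd hL b₀ b₁ Mstar, ℝ → BlockNorm (toB6 (geo9Y x) 1 (H x)) (YA x → ℝ))
    (KA : ∀ x : MemberY d ℓ hd hL b₀ b₁ Mstar, B9.KernelFamily (geo9Y x) (bg x))
    (evA : ∀ x : MemberY d ℓ hd hL b₀ b₁ Mstar, (geo9Y x).Loc → XA x → ℝ)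
    (evYA : ∀ x : MemberY d ℓ hd hL b₀ b₁ Mstar, (geo9Y x).Loc → YA x → ℝ)
    (κA : MemberY d ℓ hd hL b₀ b₁ Mstar → Sizes310)
    (SHA SLA SIA S2A : ∀ x : MemberY d ℓ hd hL b₀ b₁ Mstar, ιA x → Finset (geo9Y x).Site)
    (hstA : ∀ x, StaticOK310 (𝔬A x) q.ρ q.Nc q.N' q.NF q.Cℓ (κA x)) (hκA : ∀ x, (κA x).Bounded q.Kc)
    (hrdA : ∀ x, (rdA x).OK (𝔬A x).blk) (hlocA : ∀ x, Locality310 (𝔬A x) (rdA x))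
    (h36A : ∀ x, q.M₁ ≤ (geo9Y x).M → ∀ α₀ : ℝ, 0 < α₀ → c35 * (geo9Y x).M * α₀ ≤ q.a₁ →
      ∀ U : (bg x).Cfg, (bg x).Reg335 c35 α₀ U →
        Local342G (𝔬A x) 1 (H x) q.B₀ q.δ₀ U ∧ B9Thm310Whole.Factors389 (𝔬A x) 1 (H x) q.θ₀ q.δ₀ U ∧
          Identities310 (𝔬A x) 1 (H x) U)
    (h36HA : ∀ x, q.M₁ ≤ (geo9Y x).M → ∀ α₀ : ℝ, 0 < α₀ → c35 * (geo9Y x).M * α₀ ≤ q.a₁ →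
      ∀ U : (bg x).Cfg, (bg x).Reg335 c35 α₀ U →
        HolderLegs310 (𝔬A x) (𝔭A x) 1 (H x) (SHA x) q.Bl q.δ₀ U ∧ FactorsHolder310 (𝔬A x) (𝔭A x) 1 (H x) q.Bt q.δ₀ U ∧
          LapLegs310 (𝔬A x) 1 (H x) (SLA x) q.BL q.δ₀ U ∧
            InputLegs310 (𝔬A x) (𝔭A x) 1 (H x) (bHA x) (SIA x) q.BI q.BI2 q.δ₀ U ∧
              FactorsInput310 (𝔬A x) 1 (H x) (bHA x) q.θI q.δ₀ U ∧
                L2TwoLegs310 (𝔬A x) 1 (H x) (S2A x) q.B2 q.δ₀ U ∧ FactorsL2_310 (𝔬A x) 1 (H x) q.θ2 q.δ₀ U)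
    (hcoA0 : ∀ x U, CoRealizesRel (KA x) 0 U (Rel x) (𝔬A x).blk (𝔬A x).blk (evA x) ((𝔬A x).G U))
    (hcoA1 : ∀ x U, CoRealizesRel (KA x) 1 U (Rel x) (𝔬A x).blkY (𝔬A x).blk (evA x) ((𝔬A x).D U ∘ₗ (𝔬A x).G U))
    (hcoA2 : ∀ x U, CoRealizesRel (KA x) 2 U (Rel x) (𝔬A x).blk (𝔬A x).blkY (evYA x) ((𝔬A x).G U ∘ₗ (𝔬A x).Dstar U))
    (hcoA3 : ∀ x U, CoRealizesRel (KA x) 3 U (Rel x) (𝔬A x).blk (𝔬A x).blk (evA x) ((𝔬A x).Lap U ∘ₗ (𝔬A x).G U))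
    (hglA0 : ∀ x U, GlobReads (KA x) 0 U (𝔬A x).blk (𝔬A x).blk (evA x) ((𝔬A x).G U))
    (hglA1 : ∀ x U, GlobReads (KA x) 1 U (𝔬A x).blkY (𝔬A x).blk (evA x) ((𝔬A x).D U ∘ₗ (𝔬A x).G U))
    (hglA2 : ∀ x U, GlobReads (KA x) 2 U (𝔬A x).blk (𝔬A x).blkY (evYA x) ((𝔬A x).G U ∘ₗ (𝔬A x).Dstar U))
    (hglA3 : ∀ x U, GlobReads (KA x) 3 U (𝔬A x).blk (𝔬A x).blk (evA x) ((𝔬A x).Lap U ∘ₗ (𝔬A x).G U))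
    (hlA0 : ∀ x U, L2ReadsRel (R := 1) (H := H x) (KA x) 0 U (Rel x) (𝔬A x).blk (𝔬A x).blk (evA x) ((𝔬A x).G U))
    (hlA1 : ∀ x U, L2ReadsRel (R := 1) (H := H x) (KA x) 1 U (Rel x) (𝔬A x).blkY (𝔬A x).blk (evA x) ((𝔬A x).D U ∘ₗ (𝔬A x).G U))
    (hlA2 : ∀ x U, L2ReadsRel (R := 1) (H := H x) (KA x) 2 U (Rel x) (𝔬A x).blk (𝔬A x).blkY (evYA x) ((𝔬A x).G U ∘ₗ (𝔬A x).Dstar U))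
    (hlA3 : ∀ x U, L2ReadsRel (R := 1) (H := H x) (KA x) 3 U (Rel x) (𝔬A x).blk (𝔬A x).blk (evA x) ((𝔬A x).Lap U ∘ₗ (𝔬A x).G U))
    (hlA4 : ∀ x U, L2ReadsRel (R := 1) (H := H x) (KA x) 4 U (Rel x) (𝔬A x).blkY (𝔬A x).blkY (evYA x)
      ((𝔬A x).D U ∘ₗ ((𝔬A x).G U ∘ₗ (𝔬A x).Dstar U)))
    (hlA5 : ∀ x U, L2ReadsRel (R := 1) (H := H x) (KA x) 5 U (Rel x) (𝔬A x).blk (𝔬A x).blk (evA x) ((𝔬A x).G U ∘ₗ (𝔬A x).Lap U))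
    (hH1A : ∀ x U, H1ReadsRel (KA x) U (𝔭A x) (Rel x) (𝔬A x).blk (𝔬A x).blkY (evA x) (evYA x) ((𝔬A x).D U ∘ₗ (𝔬A x).G U)
      ((𝔬A x).G U ∘ₗ (𝔬A x).Dstar U))
    (hIRA : ∀ x U, InputReadsRel (KA x) U (𝔭A x) (bHA x) (Rel x) (𝔬A x).blkY (evYA x) ((𝔬A x).D U ∘ₗ ((𝔬A x).G U ∘ₗ (𝔬A x).Dstar U)))
    (hsymA : ∀ x U, IsTransposePair ((𝔬A x).G U) ((𝔬A x).G U))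
    (htrA : ∀ x U, IsTransposePair ((𝔬A x).D U ∘ₗ (𝔬A x).G U) ((𝔬A x).G U ∘ₗ (𝔬A x).Dstar U))
    (hadjLA : ∀ x U, IsTransposePair ((𝔬A x).Lap U ∘ₗ (𝔬A x).G U) ((𝔬A x).G U ∘ₗ (𝔬A x).Lap U))
    (hcntHA : ∀ x (a : (geo9Y x).Site), (∑ c, if a ∈ SHA x c then (1 : ℝ) else 0) ≤ q.NH)
    (hcntLA : ∀ x (a : (geo9Y x).Site), (∑ c, if a ∈ SLA x c then (1 : ℝ) else 0) ≤ q.NL)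
    (hcntIA : ∀ x (a : (geo9Y x).Site), (∑ c, if a ∈ SIA x c then (1 : ℝ) else 0) ≤ q.NI)
    (hcnt2A : ∀ x (a : (geo9Y x).Site), (∑ c, if a ∈ S2A x c then (1 : ℝ) else 0) ≤ q.N2) :
    B9.Thm37Printed c35 geo9Y bg (fun x => E37YRel (bg := bg) m p q (𝔬 x) (rd x) (H x) (K x)) ∧
      B9.Cor38Printed c35 geo9Y bg (fun x => E37YRel (bg := bg) m p q (𝔬 x) (rd x) (H x) (K x)) ∧
      B9.Thm310Printed c35 geo9Y bg (fun x => E310YRel (bg := bg) m p q (𝔬A x) (rdA x) (H x) (KA x)) ∧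
      B9.RWSumsYieldIneqs geo9Y bg (fun x => E37YRel (bg := bg) m p q (𝔬 x) (rd x) (H x) (K x))
        (fun x => E310YRel (bg := bg) m p q (𝔬A x) (rdA x) (H x) (KA x)) K KA := by
  set dp : ℕ := exp261 (@geo9Y d ℓ hd hL b₀ b₁ Mstar) p.δ₀ p.α with hdp
  set dFp : ℕ := exp261 (@geo9Y d ℓ hd hL b₀ b₁ Mstar) ((1 - 2 * p.α) * p.δ₀) (1 - p.αF) with hdFp
  set dq : ℕ := exp261 (@geo9Y d ℓ hd hL b₀ b₁ Mstar) q.δ₀ q.α with hdq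
  set dFq : ℕ := exp261 (@geo9Y d ℓ hd hL b₀ b₁ Mstar) ((1 - 2 * q.α) * q.δ₀) (1 - q.αF) with hdFq
  set L₀ : ℝ := ((ℓ + 1 : ℕ) : ℝ) with hL₀
  have hL₀0 : 0 ≤ L₀ := by rw [hL₀]; positivity
  have hBp := lowerB_le_B1Y_left' p q dp dFp dq dFq L₀
  have hBq := lowerB_le_B1Y_right' p q dp dFp dq dFq L₀
  have hB1 : 0 ≤ B1Y p q dp dFp dq dFq L₀ := (B1Y_pos p q dp dFp dq dFq L₀).le
  have hs1 : (1 : ℝ) ≤ relScale m := by unfold relScale; nlinarith [sq_nonneg (m : ℝ)]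
  have hs0 : (0 : ℝ) ≤ relScale m := zero_le_one.trans hs1
  have hsm : (m : ℝ) ≤ relScale m := by
    unfold relScale; nlinarith [sq_nonneg ((m : ℝ) - 1), (Nat.cast_nonneg m : (0 : ℝ) ≤ m)]
  have hsmm : (m : ℝ) * m ≤ relScale m := by unfold relScale; linarith
  have hm0 : (0 : ℝ) ≤ m := Nat.cast_nonneg m
  -- the scaled relations: m·X ≤ s·B, m²·X ≤ s·B, X ≤ s·B for 0 ≤ X ≤ B, 0 ≤ B
  have sc1 : ∀ {X B : ℝ}, 0 ≤ X → X ≤ B → (m : ℝ) * X ≤ relScale m * B := fun hX hXB =>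
    (mul_le_mul hsm hXB hX hs0)
  have sc2 : ∀ {X B : ℝ}, 0 ≤ X → X ≤ B → (m : ℝ) * m * X ≤ relScale m * B := fun hX hXB =>
    (mul_le_mul hsmm hXB hX hs0)
  have sc0 : ∀ {X B : ℝ}, X ≤ B → 0 ≤ B → X ≤ relScale m * B := fun hXB hB =>
    hXB.trans (le_mul_of_one_le_left hB hs1)
  have hCp : 0 ≤ p.C dp := PinPrims.C_nonneg hp dp
  have hCq : 0 ≤ q.C dq := PinPrims.C_nonneg hq dq
  have hc1p : 0 ≤ B6.c1 dp p.δ₀ p.α := c1_nonneg _ _ _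
  have hc1q : 0 ≤ B6.c1 dq q.δ₀ q.α := c1_nonneg _ _ _
  have htwo_p : 0 ≤ twoConst dp p.δ₀ p.α p.N2 p.B2 p.N' p.θ2 (p.C dp) L₀ := by
    have := hp.N2_nn; have := hp.B2_nn; have := hp.N'_nn; have := hp.θ2_nn
    unfold twoConst; positivity
  have htwo_q : 0 ≤ twoConst dq q.δ₀ q.α q.N2 q.B2 q.NF q.θ2 (q.C dq) L₀ := by
    have := hq.N2_nn; have := hq.B2_nn; have := hq.NF_nn; have := hq.θ2_nn
    unfold twoConst; positivity
  have hhold_p : ∀ β, 0 ≤ β → β < 1 → 0 ≤ holderConst dp p.δ₀ p.α p.NH p.N' (p.C dp) (p.Bl β) (p.Bt β) := by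
    intro β h0 h1
    have := hp.NH_nn; have := hp.N'_nn; have := hp.Bl_nn β h0 h1; have := hp.Bt_nn β h0 h1
    unfold holderConst; positivity
  have hhold_q : ∀ β, 0 ≤ β → β < 1 → 0 ≤ holderConst dq q.δ₀ q.α q.NH q.NF (q.C dq) (q.Bl β) (q.Bt β) := by
    intro β h0 h1
    have := hq.NH_nn; have := hq.NF_nn; have := hq.Bl_nn β h0 h1; have := hq.Bt_nn β h0 h1
    unfold holderConst; positivity
  have hBβ0 : ∀ β, 0 ≤ β → β < 1 → 0 ≤ BbetaY p q dp dq β := fun β h0 h1 => (hhold_p β h0 h1).trans (le_max_left _ _)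
  obtain ⟨t37, c38⟩ := thm37_cor38_complete_geo9Y_rel (bg := bg) (B₁ := relScale m * B1Y p q dp dFp dq dFq L₀)
    (δ₁ := delta1Y p q) (Bβ := fun β => relScale m * BbetaY p q dp dq β) (Bε := BepsY p q dp dq L₀)
    (Bεβ := BepsbetaY p q dp dq L₀) 𝔬 rd H 𝔭 bH K ev evY Rel m hRlen hRd₁ hRd₂ hmult κ SH SL SI S2
    p.Bl p.Bt p.BI p.θI p.BI2 p.α p.ρ p.Nc p.N' p.Cℓ p.Kc p.θ₀ p.B₀ p.δ₀ p.a₁ p.M₁ p.αF p.NH p.NL p.BL p.NI p.N2 p.B2 p.θ2 hc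
    hp.α_pos hp.α_lt hp.Nc_nn hp.N'_nn hp.one_le_Cℓ hp.Kc_nn hp.θ₀_nn hp.B₀_pos hp.δ₀_pos hp.a₁_pos hp.M₁_pos hp.αF_pos
    hp.αF_lt.le hp.NH_nn hp.NL_nn hp.BL_nn hp.NI_nn hp.N2_nn hp.B2_nn hp.θ2_nn hst hκ hrd hloc h36 h36H hco0 hco1 hco2 hco3 hgl0
    hgl1 hgl2 hgl3 hl0 hl1 hl2 hl3 hl4 hl5 hH1 hIR hsym htr hadjL hcntH hcntL hcntI hcnt2 hp.Bl_nn hp.Bt_nn hp.BI_nn hp.BI2_nn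
    hp.θI_nn (sc1 hCp ((le_pinLowerB₁' _ _ _ _ _).trans hBp))
    (sc2 (mul_nonneg hCp hL₀0) ((le_pinLowerB₂' _ _ _ _ _).trans hBp)) (min_le_left _ _)
    (sc0 ((le_pinLowerB₃' _ _ _ _ _).trans hBp) hB1)
    (sc2 (mul_nonneg (Real.sqrt_nonneg _) hL₀0) ((le_pinLowerB₄' _ _ _ _ _).trans hBp))
    (sc2 htwo_p ((le_pinLowerB₅' _ _ _ _ _).trans hBp))
    (fun β h0 h1 => sc1 (hhold_p β h0 h1) (le_max_left _ _)) (fun ε _ _ => le_max_left _ _)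
    (fun ε β _ _ _ _ => le_max_left _ _)
  have t310 := thm310_complete_geo9Y_rel (bg := bg) (B₁ := relScale m * B1Y p q dp dFp dq dFq L₀) (δ₁ := delta1Y p q)
    (Bβ := fun β => relScale m * BbetaY p q dp dq β) (Bε := BepsY p q dp dq L₀) (Bεβ := BepsbetaY p q dp dq L₀) 𝔬A rdA H 𝔭A
    bHA KA evA evYA Rel m hRlen hRd₁ hRd₂ hmult κA SHA SLA SIA S2A q.Bl q.Bt q.BI q.θI q.BI2 q.α q.ρ q.Nc q.N' q.NF q.Cℓ q.Kc
    q.θ₀ q.B₀ q.δ₀ q.a₁ q.M₁ q.αF q.NH q.NL q.BL q.NI q.N2 q.B2 q.θ2 hc hq.α_pos hq.α_lt hq.Nc_nn hq.N'_nn hq.NF_nn hq.one_le_Cℓ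
    hq.Kc_nn hq.θ₀_nn hq.B₀_pos hq.δ₀_pos hq.a₁_pos hq.M₁_pos hq.αF_pos hq.αF_lt.le hq.NH_nn hq.NL_nn hq.BL_nn hq.NI_nn hq.N2_nn
    hq.B2_nn hq.θ2_nn hstA hκA hrdA hlocA h36A h36HA hcoA0 hcoA1 hcoA2 hcoA3 hglA0 hglA1 hglA2 hglA3 hlA0 hlA1 hlA2 hlA3 hlA4 hlA5
    hH1A hIRA hsymA htrA hadjLA hcntHA hcntLA hcntIA hcnt2A hq.Bl_nn hq.Bt_nn hq.BI_nn hq.BI2_nn hq.θI_nn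
    (sc1 hCq ((le_pinLowerB₁' _ _ _ _ _).trans hBq))
    (sc2 (mul_nonneg hCq hL₀0) ((le_pinLowerB₂' _ _ _ _ _).trans hBq)) (min_le_right _ _)
    (sc0 ((le_pinLowerB₃' _ _ _ _ _).trans hBq) hB1)
    (sc2 (mul_nonneg (Real.sqrt_nonneg _) hL₀0) ((le_pinLowerB₄' _ _ _ _ _).trans hBq))
    (sc2 htwo_q ((le_pinLowerB₅' _ _ _ _ _).trans hBq))
    (fun β h0 h1 => sc1 (hhold_q β h0 h1) (le_max_right _ _)) (fun ε _ _ => le_max_right _ _)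
    (fun ε β _ _ _ _ => le_max_right _ _)
  exact ⟨t37, c38, t310, rwSumsYieldIneqs_allPins _ 𝔬 (fun _ => 1) H _ _ 𝔬A rdA (fun _ => 1) H _ _ K KA _ _ _
    (mul_pos (lt_of_lt_of_le one_pos hs1) (B1Y_pos p q dp dFp dq dFq L₀)) (delta1Y_pos hp hq)⟩

end StageY

end

end Literature.MathematicalPhysics.QuantumFieldTheory.Balaban1983to89.B9RWSumsDefinitePinsRel
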